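import Summits.Ventures.YMGap.FlowData.TubeGaugeInvariance
import Summits.Ventures.YMGap.FlowData.TubePolyakovLine
import Summits.Ventures.YMGap.FlowData.TubeTransferBilinearReduction
import Summits.Ventures.YMGap.FlowData.LinkWeightExpansion
import Summits.Ventures.YMGap.FlowData.LinkCharacterBessel
import Summits.Ventures.YMGap.FlowData.PolyakovHaarChain
import Literature.MathematicalPhysics.QuantumFieldTheory.FlatLatticeGaugeFields

/-!
# Venture YMGap, track Y3 FLOW-DATA — the Gauss-law kinetic kernel ON GAUGE-INVARIANT FUNCTIONS is the un-averaged
# link weight, and the SU(2) link weight is DIAGONAL on the character projections: `W (p_ν f) = q_ν · p_ν f`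
# (the kept eigen-structure `𝒦 f = q_ν f` of the operator-level tail theorem, for spin networks; theorems only)

HONEST FRAMING: venture file of the cell `pub-ymgap` (QuantumFields programme), track Y3, lineage A (seat flow-eng-1).
Finite Haar integrals over `G^{links}` of a time slice of the tube `(ℤ/L)^k`; no number, no row, nothing about
`L → ∞`, the continuum or a mass gap.  NO Peter–Weyl.

WHY.  After `KWeightTailTubeKinetic` (`⟪x, T x⟫ = ⟪M x, 𝒦 (M x)⟫`, `𝒦 ⪰ 0`), what the operator-level kept-set tail
theorem `KWeightTailOperator` still takes as a HYPOTHESIS about the tube is the kept structure of the Gauss-law kinetic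
operator `𝒦` (kernel `k(a,b) = ∫ exp(J·elecSum(a,E,b)) dE`): `𝒦 f_i = q_i f_i` on the kept spin networks, and the
dropped bound.  This file proves the eigen-relation from two facts:

* §1 (any compact `G`, continuous `ρ`) **`integral_kineticKernel_mul_eq_of_isGaugeInvariant`** — the temporal links are
  a gauge transformation of the later slice (`elecSum_eq_elecSum_one_gaugeTransform`: `elecSum(a,E,b) =
  elecSum(a,1,b^E)`), so on a GAUGE-INVARIANT `f` the Gauss-law average is invisible:
  `∫ k(a,b) f(b) db = ∫ e^{J·elecSum(a,1,b)} f(b) db` (change of variables `b ↦ b^E`, `measurePreserving_gaugeTransform`);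
* §2 (`SU(2)`, fundamental, `J = β/2 ≥ 0`) **`integral_weight_mul_charProj_eq`** — the un-averaged weight
  `W(a,b) = Π_e e^{β a₀(b_e a_e⁻¹)}` is DIAGONAL on the character projections of `LinkCharacterMerging`:
  `∫ W(a,b) (p_ν h)(b) db = q_ν(β) · (p_ν h)(a)`, `q_ν = Π_e (I_{ν_e}(β) − I_{ν_e+2}(β))/(ν_e+1)` (the link weights of
  ENGINE §1: `q_ν / q_0 = Π a_{j}` with `ν = 2j`), from p1's series `SU2Links.integral_weight_mul_eq_tsum` and the POINTWISE
  reproducing property `charProj_charProj_apply` (`p_ν' (p_ν h) = [ν = ν'] p_ν h`, by the merging rule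
  `SU2Links.integral_prod_su2Character_mul_prod` and Fubini);
* §3 **`integral_kineticKernel_mul_eq_smul_of_net`** — hence for a continuous gauge-invariant `f` reproduced by `p_ν`
  (`p_ν f = f`: a spin network of link type `ν`), `∫ k(a,b) f(b) db = q_ν f(a)` for every `a`; and
  **`kineticOp_apply_net`** — for any operator `𝒦` on `L²` acting a.e. by the kinetic kernel (`exists_kineticOp`),
  `𝒦 f = q_ν • f` in `L²`: hypothesis `hq` of `KWeightTailOperator` for the tube's kept nets.

WHAT IS NOT HERE: the dropped bound `κ_T` (needs that the engine's nets EXHAUST the gauge-invariant part of the kept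
isotypic components — the intertwiner count; `KWeightTailOperatorDropped` is the abstract frame); numbers.

References: M. Creutz, *Quarks, gluons and lattices* (1983) Ch. 9; I. Montvay, G. Münster (1994) §3.2.6, §3.4.2
[cite: MontvayMunster1994, §3.4.2]; M. Lüscher, Commun. Math. Phys. 54 (1977) 283 [cite: Luscher1977].
-/

noncomputable section

open scoped BigOperators ENNReal
open MeasureTheory Filter Function Polynomial.Chebyshev
open Literature.MathematicalPhysics.QuantumFieldTheory Literature.Analysis.OperatorTheory
open Literature.MathematicalPhysics.QuantumLattice Literature.Analysis.FunctionSpaces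
open Summit.Ventures.LatticeQCDFlow.Exactness Summit.Ventures.LatticeQCDFlow.Scoring

namespace Summit.Ventures.YMGap.FlowData

namespace KWeightTailOperator

/-! ### §1 The Gauss-law average is invisible on gauge-invariant functions (any compact `G`) -/

section Gauss

variable {G : Type*} [Group G] [TopologicalSpace G] [IsTopologicalGroup G] [CompactSpace G]
  [MeasurableSpace G] [BorelSpace G] [SecondCountableTopology G] {n : ℕ} (ρ : G →* Matrix (Fin n) (Fin n) ℂ)
  (J : ℝ) {k L : ℕ} [NeZero L]

omit [TopologicalSpace G] [IsTopologicalGroup G] [CompactSpace G] [MeasurableSpace G] [BorelSpace G]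
  [SecondCountableTopology G] in
/-- **The temporal links are a gauge transformation of the later slice**: `elecSum(a, E, b) = elecSum(a, 1, b^E)`.
[cite: Luscher1977] -/
theorem elecSum_eq_elecSum_one_gaugeTransform (a b : GaugeConfig k L G) (E : Site k L → G) :
    elecSum (d := k) (L := L) ρ a E b = elecSum (d := k) (L := L) ρ a 1 (gaugeTransform E b) := by
  unfold elecSum
  refine Finset.sum_congr rfl fun x _ => Finset.sum_congr rfl fun i _ => ?_
  simp only [gaugeTransform, Site.shift, Pi.one_apply, inv_one, one_mul, mul_one]

/-- **On a gauge-invariant function the Gauss-law kinetic kernel acts as the un-averaged weight**: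
`∫ (∫ e^{J elecSum(a,E,b)} dE) f(b) db = ∫ e^{J elecSum(a,1,b)} f(b) db` for continuous gauge-invariant `f`.
[cite: Luscher1977] -/
theorem integral_kineticKernel_mul_eq_of_isGaugeInvariant (hρ : Continuous ρ) {f : GaugeConfig k L G → ℝ}
    (hfc : Continuous f) (hfg : IsGaugeInvariant f) (a : GaugeConfig k L G) :
    ∫ b, (∫ E, Real.exp (J * elecSum (d := k) (L := L) ρ a E b) ∂(Measure.pi fun _ : Site k L => haarProbability G)) *
        f b ∂(sliceMeasure G k L) =
      ∫ b, Real.exp (J * elecSum (d := k) (L := L) ρ a 1 b) * f b ∂(sliceMeasure G k L) := by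
  set μ := sliceMeasure G k L with hμ
  set πE := (Measure.pi fun _ : Site k L => haarProbability G) with hπE
  -- the integrand `(E, b) ↦ e^{J elecSum(a,E,b)} f(b)` is continuous on a compact space, hence integrable
  have hexp : Continuous fun z : (Site k L → G) × GaugeConfig k L G =>
      Real.exp (J * elecSum (d := k) (L := L) ρ a z.1 z.2) :=
    Continuous.comp (g := fun q : (GaugeConfig k L G × (Site k L → G)) × GaugeConfig k L G =>
        Real.exp (J * elecSum (d := k) (L := L) ρ q.1.1 q.1.2 q.2))
      (f := fun z : (Site k L → G) × GaugeConfig k L G => ((a, z.1), z.2))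
      (continuous_exp_elecSum_pair ρ J hρ) ((continuous_const.prodMk continuous_fst).prodMk continuous_snd)
  have hcont : Continuous fun z : (Site k L → G) × GaugeConfig k L G =>
      Real.exp (J * elecSum (d := k) (L := L) ρ a z.1 z.2) * f z.2 :=
    hexp.mul (hfc.comp continuous_snd)
  have hint : Integrable (uncurry fun (E : Site k L → G) (b : GaugeConfig k L G) =>
      Real.exp (J * elecSum (d := k) (L := L) ρ a E b) * f b) (πE.prod μ) :=
    hcont.integrable_of_hasCompactSupport
      (IsCompact.of_isClosed_subset isCompact_univ (isClosed_tsupport _) (Set.subset_univ _))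
  -- pull `f b` into the `E`-integral and swap
  have h1 : ∀ b : GaugeConfig k L G,
      (∫ E, Real.exp (J * elecSum (d := k) (L := L) ρ a E b) ∂πE) * f b =
        ∫ E, Real.exp (J * elecSum (d := k) (L := L) ρ a E b) * f b ∂πE := fun b =>
    (integral_mul_const (f b) fun E : Site k L → G => Real.exp (J * elecSum (d := k) (L := L) ρ a E b)).symm
  simp_rw [h1]
  rw [← integral_integral_swap hint]
  -- for each `E`, change variables `b ↦ b^E` and use gauge invariance
  have h2 : ∀ E : Site k L → G,
      ∫ b, Real.exp (J * elecSum (d := k) (L := L) ρ a E b) * f b ∂μ =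
        ∫ b, Real.exp (J * elecSum (d := k) (L := L) ρ a 1 b) * f b ∂μ := by
    intro E
    have hmp : MeasurePreserving (gaugeTransform E : GaugeConfig k L G → GaugeConfig k L G) μ μ :=
      WilsonGauge.measurePreserving_gaugeTransform E
    have hgc : Continuous fun b : GaugeConfig k L G => Real.exp (J * elecSum (d := k) (L := L) ρ a 1 b) * f b :=
      (hexp.comp (Continuous.prodMk continuous_const continuous_id)).mul hfc
    have h := integral_map (μ := μ) hmp.measurable.aemeasurable (hgc.aestronglyMeasurable (μ := Measure.map
      (gaugeTransform E) μ))
    rw [hmp.map_eq] at h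
    rw [h]
    refine integral_congr_ae (Eventually.of_forall fun b => ?_)
    simp only
    rw [elecSum_eq_elecSum_one_gaugeTransform, hfg E b]
  simp_rw [h2]
  rw [integral_const, smul_eq_mul]
  simp [hπE]

end Gauss

/-! ### §2 The SU(2) link weight is diagonal on the character projections -/

section SUTwo

variable {ι : Type} [Fintype ι]

/-- **Pointwise reproducing property of the character projections**: `p_ν' (p_ν h) = [ν = ν'] p_ν h` at every point
(`p_ν h = d_ν ∫ X_ν(·, b) h(b) db`; the multi-link merging rule `SU2Links.integral_prod_su2Character_mul_prod` and Fubini).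
[cite: MontvayMunster1994, §3.4.2] -/
theorem charProj_charProj_apply (ν ν' : ι → ℕ) {h : (ι → (Matrix.specialUnitaryGroup (Fin 2) ℂ)) → ℝ}
    (hh : Integrable h ((Measure.pi fun _ : ι => haarProbability (Matrix.specialUnitaryGroup (Fin 2) ℂ)))) (a : ι → (Matrix.specialUnitaryGroup (Fin 2) ℂ)) :
    (∏ e, ((ν' e : ℝ) + 1)) * ∫ V, (∏ e, (U ℝ (ν' e)).eval (su2a0 (V e * (a e)⁻¹))) *
        ((∏ e, ((ν e : ℝ) + 1)) * ∫ c, (∏ e, (U ℝ (ν e)).eval (su2a0 (c e * (V e)⁻¹))) * h c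
          ∂((Measure.pi fun _ : ι => haarProbability (Matrix.specialUnitaryGroup (Fin 2) ℂ))))
        ∂((Measure.pi fun _ : ι => haarProbability (Matrix.specialUnitaryGroup (Fin 2) ℂ))) =
      if ν = ν' then (∏ e, ((ν e : ℝ) + 1)) * ∫ c, (∏ e, (U ℝ (ν e)).eval (su2a0 (c e * (a e)⁻¹))) * h c
          ∂((Measure.pi fun _ : ι => haarProbability (Matrix.specialUnitaryGroup (Fin 2) ℂ))) else 0 := by
  set μ := (Measure.pi fun _ : ι => haarProbability (Matrix.specialUnitaryGroup (Fin 2) ℂ)) with hμ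
  -- the double integrand `(V, c) ↦ X_ν'(a,V) X_ν(V,c) h(c)` is integrable on `μ ⊗ μ`
  have hF : Integrable (uncurry fun (V : ι → (Matrix.specialUnitaryGroup (Fin 2) ℂ)) (c : ι → (Matrix.specialUnitaryGroup (Fin 2) ℂ)) =>
      (∏ e, (U ℝ (ν' e)).eval (su2a0 (V e * (a e)⁻¹))) *
        ((∏ e, (U ℝ (ν e)).eval (su2a0 (c e * (V e)⁻¹))) * h c)) (μ.prod μ) := by
    have h1 : Integrable (fun z : (ι → (Matrix.specialUnitaryGroup (Fin 2) ℂ)) × (ι → (Matrix.specialUnitaryGroup (Fin 2) ℂ)) =>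
        (1 : ℝ) * h z.2) (μ.prod μ) := (integrable_const (1 : ℝ)).mul_prod hh
    have h2 : Integrable (fun z : (ι → (Matrix.specialUnitaryGroup (Fin 2) ℂ)) × (ι → (Matrix.specialUnitaryGroup (Fin 2) ℂ)) =>
        ((∏ e, (U ℝ (ν' e)).eval (su2a0 (z.1 e * (a e)⁻¹))) *
          (∏ e, (U ℝ (ν e)).eval (su2a0 (z.2 e * (z.1 e)⁻¹)))) * ((1 : ℝ) * h z.2)) (μ.prod μ) := by
      refine h1.bdd_mul (c := (∏ e, ((ν' e : ℝ) + 1)) * ∏ e, ((ν e : ℝ) + 1)) ?_ (Eventually.of_forall fun z => ?_)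
      · exact (((SU2Links.continuous_prod_su2Character_right ν' a).comp continuous_fst).mul
          ((SU2Links.continuous_prod_su2Character_pair ν).comp
            (Continuous.prodMk continuous_fst continuous_snd))).aestronglyMeasurable
      · rw [norm_mul, Real.norm_eq_abs, Real.norm_eq_abs]
        exact mul_le_mul (SU2Links.abs_prod_su2Character_le ν' _) (SU2Links.abs_prod_su2Character_le ν _) (abs_nonneg _)
          (SU2Links.prod_succ_pos ν').le
    refine h2.congr (Eventually.of_forall fun z => ?_)
    simp only [uncurry]
    ring
  -- rewrite the inner constant out, swap, merge
  have hinner : ∀ V : ι → (Matrix.specialUnitaryGroup (Fin 2) ℂ),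
      (∏ e, (U ℝ (ν' e)).eval (su2a0 (V e * (a e)⁻¹))) *
        ((∏ e, ((ν e : ℝ) + 1)) * ∫ c, (∏ e, (U ℝ (ν e)).eval (su2a0 (c e * (V e)⁻¹))) * h c ∂μ) =
      (∏ e, ((ν e : ℝ) + 1)) * ∫ c, (∏ e, (U ℝ (ν' e)).eval (su2a0 (V e * (a e)⁻¹))) *
        ((∏ e, (U ℝ (ν e)).eval (su2a0 (c e * (V e)⁻¹))) * h c) ∂μ := by
    intro V
    rw [mul_left_comm, ← integral_const_mul]
  simp_rw [hinner]
  rw [integral_const_mul, integral_integral_swap hF]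
  -- inner `V`-integral = merging rule
  have hmerge : ∀ c : ι → (Matrix.specialUnitaryGroup (Fin 2) ℂ),
      ∫ V, (∏ e, (U ℝ (ν' e)).eval (su2a0 (V e * (a e)⁻¹))) *
          ((∏ e, (U ℝ (ν e)).eval (su2a0 (c e * (V e)⁻¹))) * h c) ∂μ =
        (if ν' = ν then (∏ e, (U ℝ (ν' e)).eval (su2a0 (c e * (a e)⁻¹))) / ∏ e, ((ν' e : ℝ) + 1) else 0) * h c := by
    intro c
    have h := SU2Links.integral_prod_su2Character_mul_prod (ι := ι) ν' ν a c
    rw [← h, ← integral_mul_const]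
    refine integral_congr_ae (Eventually.of_forall fun V => ?_)
    ring
  simp_rw [hmerge]
  by_cases hνν : ν = ν'
  · subst hνν
    simp only [if_true]
    have hd : (∏ e, ((ν e : ℝ) + 1)) ≠ 0 := (SU2Links.prod_succ_pos ν).ne'
    congr 1
    rw [← integral_const_mul]
    refine integral_congr_ae (Eventually.of_forall fun c => ?_)
    simp only
    field_simp
  · have hνν' : ¬ ν' = ν := fun h => hνν h.symm
    simp [hνν, hνν']

/-- **The SU(2) link weight is diagonal on the character projections**:
`∫ (Π_e e^{β a₀(b_e a_e⁻¹)}) (p_ν h)(b) db = q_ν(β) (p_ν h)(a)` with `q_ν = Π_e (I_{ν_e}(β) − I_{ν_e+2}(β))/(ν_e+1)`,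
for `β ≥ 0` and integrable `h` (p1's series `SU2Links.integral_weight_mul_eq_tsum` at `p_ν h`, collapsed by
`charProj_charProj_apply`). [cite: MontvayMunster1994, §3.4.2] -/
theorem integral_weight_mul_charProj_eq {β : ℝ} (hβ : 0 ≤ β) (ν : ι → ℕ) {h : (ι → (Matrix.specialUnitaryGroup (Fin 2) ℂ)) → ℝ}
    (hh : Integrable h ((Measure.pi fun _ : ι => haarProbability (Matrix.specialUnitaryGroup (Fin 2) ℂ)))) (a : ι → (Matrix.specialUnitaryGroup (Fin 2) ℂ)) :
    ∫ b, (∏ e, Real.exp (β * su2a0 (b e * (a e)⁻¹))) *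
        ((∏ e, ((ν e : ℝ) + 1)) * ∫ c, (∏ e, (U ℝ (ν e)).eval (su2a0 (c e * (b e)⁻¹))) * h c
          ∂((Measure.pi fun _ : ι => haarProbability (Matrix.specialUnitaryGroup (Fin 2) ℂ))))
        ∂((Measure.pi fun _ : ι => haarProbability (Matrix.specialUnitaryGroup (Fin 2) ℂ))) =
      (∏ e, (besselI (ν e) β - besselI (ν e + 2) β) / ((ν e : ℝ) + 1)) *
        ((∏ e, ((ν e : ℝ) + 1)) * ∫ c, (∏ e, (U ℝ (ν e)).eval (su2a0 (c e * (a e)⁻¹))) * h c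
          ∂((Measure.pi fun _ : ι => haarProbability (Matrix.specialUnitaryGroup (Fin 2) ℂ)))) := by
  set μ := (Measure.pi fun _ : ι => haarProbability (Matrix.specialUnitaryGroup (Fin 2) ℂ)) with hμ
  -- `p_ν h` is integrable (continuous on a compact space)
  have hpc := SU2Links.continuous_charProj (ι := ι) ν hh
  have hpi : Integrable (fun b : ι → (Matrix.specialUnitaryGroup (Fin 2) ℂ) => (∏ e, ((ν e : ℝ) + 1)) *
      ∫ c, (∏ e, (U ℝ (ν e)).eval (su2a0 (c e * (b e)⁻¹))) * h c ∂μ) μ :=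
    hpc.integrable_of_hasCompactSupport
      (IsCompact.of_isClosed_subset isCompact_univ (isClosed_tsupport _) (Set.subset_univ _))
  rw [SU2Links.integral_weight_mul_eq_tsum (ι := ι) hβ hpi a]
  -- every term with `ν' ≠ ν` vanishes
  rw [tsum_eq_single ν]
  · rw [charProj_charProj_apply ν ν hh a, if_pos rfl]
  · intro ν' hν'
    rw [charProj_charProj_apply ν ν' hh a, if_neg (fun h => hν' h.symm), mul_zero]

end SUTwo

/-! ### §3 The kinetic kernel on a gauge-invariant spin network of link type `ν`: `𝒦 f = q_ν f` -/

section Net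

variable {k L : ℕ} [NeZero L]

/-- The un-averaged SU(2) temporal weight at `J = β/2` is the product link weight of `LinkWeightExpansion`:
`e^{(β/2) elecSum(a,1,b)} = Π_e e^{β a₀(b_e a_e⁻¹)}`. [folklore] -/
theorem exp_elecSum_one_eq_prod_su2a0 (β : ℝ) (a b : GaugeConfig k L (Matrix.specialUnitaryGroup (Fin 2) ℂ)) :
    Real.exp (β / 2 * elecSum (d := k) (L := L) (fundamentalRep (Fin 2)) a 1 b) =
      ∏ e : Edge k L, Real.exp (β * su2a0 (b e * (a e)⁻¹)) := by
  rw [exp_elecSum_one_eq_prod (fundamentalRep (Fin 2)) (β / 2) a b]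
  refine Finset.prod_congr rfl fun e _ => ?_
  rw [su2_weight_eq]
  ring_nf

/-- **The Gauss-law kinetic kernel on a spin network**: for `β ≥ 0`, a continuous gauge-invariant `f` on the slice
reproduced by the character projection of link type `ν` (`p_ν f = f` pointwise), and every `a`,
`∫ (∫ e^{(β/2) elecSum(a,E,b)} dE) f(b) db = q_ν(β) f(a)`. [cite: MontvayMunster1994, §3.4.2] -/
theorem integral_kineticKernel_mul_eq_smul_of_net {β : ℝ} (hβ : 0 ≤ β) (ν : Edge k L → ℕ)
    {f : GaugeConfig k L (Matrix.specialUnitaryGroup (Fin 2) ℂ) → ℝ} (hfc : Continuous f) (hfg : IsGaugeInvariant f)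
    (hfν : ∀ a, (∏ e, ((ν e : ℝ) + 1)) * ∫ c, (∏ e, (U ℝ (ν e)).eval (su2a0 (c e * (a e)⁻¹))) * f c
      ∂(sliceMeasure (Matrix.specialUnitaryGroup (Fin 2) ℂ) k L) = f a) (a : GaugeConfig k L (Matrix.specialUnitaryGroup (Fin 2) ℂ)) :
    ∫ b, (∫ E, Real.exp (β / 2 * elecSum (d := k) (L := L) (fundamentalRep (Fin 2)) a E b)
        ∂(Measure.pi fun _ : Site k L => haarProbability (Matrix.specialUnitaryGroup (Fin 2) ℂ))) * f b ∂(sliceMeasure (Matrix.specialUnitaryGroup (Fin 2) ℂ) k L) =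
      (∏ e, (besselI (ν e) β - besselI (ν e + 2) β) / ((ν e : ℝ) + 1)) * f a := by
  haveI : SecondCountableTopology (Matrix.specialUnitaryGroup (Fin 2) ℂ) :=
    Summit.Ventures.LatticeQCDFlow.Scoring.secondCountableTopology_su2
  rw [integral_kineticKernel_mul_eq_of_isGaugeInvariant (fundamentalRep (Fin 2)) (β / 2)
    (continuous_fundamentalRep (Fin 2)) hfc hfg a]
  simp_rw [exp_elecSum_one_eq_prod_su2a0]
  have hfi : Integrable f (sliceMeasure (Matrix.specialUnitaryGroup (Fin 2) ℂ) k L) :=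
    hfc.integrable_of_hasCompactSupport
      (IsCompact.of_isClosed_subset isCompact_univ (isClosed_tsupport _) (Set.subset_univ _))
  have h := integral_weight_mul_charProj_eq (ι := Edge k L) hβ ν hfi a
  -- replace `p_ν f` by `f` on both sides
  have hfν' : (fun b : GaugeConfig k L (Matrix.specialUnitaryGroup (Fin 2) ℂ) => (∏ e, Real.exp (β * su2a0 (b e * (a e)⁻¹))) *
      ((∏ e, ((ν e : ℝ) + 1)) * ∫ c, (∏ e, (U ℝ (ν e)).eval (su2a0 (c e * (b e)⁻¹))) * f c
        ∂(sliceMeasure (Matrix.specialUnitaryGroup (Fin 2) ℂ) k L))) =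
      fun b => (∏ e, Real.exp (β * su2a0 (b e * (a e)⁻¹))) * f b := by
    funext b; rw [hfν b]
  rw [hfν', hfν a] at h
  exact h

/-- **Hypothesis `hq` of `KWeightTailOperator` for the tube's kept nets.**  For any bounded operator `𝒦` on
`L²(slice)` acting a.e. by the Gauss-law kinetic kernel at `J = β/2 ≥ 0` (`KWeightTailTubeKinetic.exists_kineticOp`)
and a continuous gauge-invariant `f` reproduced by `p_ν`, the `L²` class of `f` is an eigenvector:
`𝒦 f = q_ν(β) • f`. [cite: MontvayMunster1994, §3.4.2] -/
theorem kineticOp_apply_net {β : ℝ} (hβ : 0 ≤ β)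
    {𝒦 : Lp ℝ 2 (sliceMeasure (Matrix.specialUnitaryGroup (Fin 2) ℂ) k L) →L[ℝ] Lp ℝ 2 (sliceMeasure (Matrix.specialUnitaryGroup (Fin 2) ℂ) k L)}
    (h𝒦 : ∀ φ : Lp ℝ 2 (sliceMeasure (Matrix.specialUnitaryGroup (Fin 2) ℂ) k L), (𝒦 φ : GaugeConfig k L (Matrix.specialUnitaryGroup (Fin 2) ℂ) → ℝ) =ᵐ[sliceMeasure (Matrix.specialUnitaryGroup (Fin 2) ℂ) k L]
      fun a => ∫ b, (∫ E, Real.exp (β / 2 * elecSum (d := k) (L := L) (fundamentalRep (Fin 2)) a E b)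
        ∂(Measure.pi fun _ : Site k L => haarProbability (Matrix.specialUnitaryGroup (Fin 2) ℂ))) * φ b ∂(sliceMeasure (Matrix.specialUnitaryGroup (Fin 2) ℂ) k L))
    (ν : Edge k L → ℕ) {f : GaugeConfig k L (Matrix.specialUnitaryGroup (Fin 2) ℂ) → ℝ} (hfc : Continuous f) (hfg : IsGaugeInvariant f)
    (hfν : ∀ a, (∏ e, ((ν e : ℝ) + 1)) * ∫ c, (∏ e, (U ℝ (ν e)).eval (su2a0 (c e * (a e)⁻¹))) * f c
      ∂(sliceMeasure (Matrix.specialUnitaryGroup (Fin 2) ℂ) k L) = f a)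
    (hf2 : MemLp f 2 (sliceMeasure (Matrix.specialUnitaryGroup (Fin 2) ℂ) k L)) :
    𝒦 (hf2.toLp f) = (∏ e, (besselI (ν e) β - besselI (ν e + 2) β) / ((ν e : ℝ) + 1)) • hf2.toLp f := by
  refine Lp.ext ?_
  have hco := hf2.coeFn_toLp
  filter_upwards [h𝒦 (hf2.toLp f), Lp.coeFn_smul ((∏ e, (besselI (ν e) β - besselI (ν e + 2) β) /
    ((ν e : ℝ) + 1))) (hf2.toLp f), hco] with a ha hs hf
  rw [ha, hs, Pi.smul_apply, hf, smul_eq_mul]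
  -- the kernel integral against the `L²` class of `f` equals the one against `f`
  have hint : ∫ b, (∫ E, Real.exp (β / 2 * elecSum (d := k) (L := L) (fundamentalRep (Fin 2)) a E b)
      ∂(Measure.pi fun _ : Site k L => haarProbability (Matrix.specialUnitaryGroup (Fin 2) ℂ))) * (hf2.toLp f) b ∂(sliceMeasure (Matrix.specialUnitaryGroup (Fin 2) ℂ) k L) =
      ∫ b, (∫ E, Real.exp (β / 2 * elecSum (d := k) (L := L) (fundamentalRep (Fin 2)) a E b)
      ∂(Measure.pi fun _ : Site k L => haarProbability (Matrix.specialUnitaryGroup (Fin 2) ℂ))) * f b ∂(sliceMeasure (Matrix.specialUnitaryGroup (Fin 2) ℂ) k L) :=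
    integral_congr_ae (by filter_upwards [hco] with b hb; rw [hb])
  rw [hint, integral_kineticKernel_mul_eq_smul_of_net hβ ν hfc hfg hfν a]

end Net

end KWeightTailOperator

end Summit.Ventures.YMGap.FlowData
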